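import Literature.Geometry.Lorentzian.MaxAtlasChart
import Literature.Geometry.Lorentzian.MetricLocality
import Literature.Geometry.Lorentzian.CoordCurvatureNormSq
import Literature.Geometry.Riemannian.RoundSphere
import HarnessLib

/-!
# Computations in a chart in which the metric is Euclidean

If a Riemannian metric `g` is the pullback `e^* δ` of the Euclidean metric on a ball of a chart
`e` of the maximal atlas (as produced by `MetricFlattening.lean` around a critical point of a
Morse function), then on that ball all intrinsic operators are the Euclidean ones of the
representatives: `|∇F|² = Σ (∂ᵢF̂)²`, `g⁻¹(dF₁, dF₂) = Σ ∂ᵢF̂₁ ∂ᵢF̂₂`, `Δ F = Σ ∂ᵢ∂ᵢ F̂` and the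
scalar curvature vanishes (O'Neill 1983, Ch. 3: the Christoffel symbols of constant components
vanish, Prop. 3.13, Lemma 3.38). Contents (all proved, no definitions):

* coordinate level, constant components `G ≡ Q₀` (`MetricCoord.…_constMetric`): `Γ = 0`,
  `Hess = D²`, `R = 0`, `Ric = 0`, `S = 0`; in a `Q₀`-orthonormal basis `♯`, `|∇F|²`, the pairing
  and `Δ` are the coordinate sums;
* manifold level (`…_of_flatOn`): the four formulas above at the points `e⁻¹ z`, `z` in the flat
  ball, through `MaxAtlasChart` and the germ-locality of the coordinate operators
  (`MetricLocality.lean`).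

## References

* B. O'Neill, *Semi-Riemannian geometry with applications to relativity*, Academic Press 1983,
  Ch. 3, Prop. 3.13, Lemma 3.38, Def. 3.53. [ONeill1983]
* S.-S. Chern, *A simple intrinsic proof of the Gauss–Bonnet formula…*, Ann. of Math. 45 (1944),
  §2. [Chern1944]
-/

noncomputable section

set_option maxSynthPendingDepth 3

open Bundle Set Function Filter Module TopologicalSpace Manifold
open scoped Manifold ContDiff Topology

namespace Literature.Geometry.Lorentzian

/-! ### Coordinate level: constant components -/

namespace MetricCoord

variable {E : Type*} [NormedAddCommGroup E] [NormedSpace ℝ E] (Q₀ : E →L[ℝ] E →L[ℝ] ℝ) {x : E}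

/-- Constant components have vanishing Koszul form. [cite: ONeill1983, Ch. 3, Prop. 3.13] -/
theorem koszulCLM_constMetric (x : E) : koszulCLM (fun _ : E ↦ Q₀) x = 0 := by
  simp only [koszulCLM, fderiv_fun_const, Pi.zero_apply, map_zero]

/-- **Constant components have vanishing Christoffel map** (`Γᵏᵢⱼ = 0`).
[cite: ONeill1983, Ch. 3, Prop. 3.13] -/
theorem chrAt_constMetric (x : E) : chrAt (fun _ : E ↦ Q₀) x = 0 := by
  simp only [chrAt, koszulCLM_constMetric, ContinuousLinearMap.comp_zero, smul_zero]

/-- For constant components the coordinate Hessian is the second derivative.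
[cite: ONeill1983, Ch. 3, Lemma 3.49] -/
theorem hessAt_constMetric (F : E → ℝ) (x : E) :
    hessAt (fun _ : E ↦ Q₀) F x = fderiv ℝ (fderiv ℝ F) x := by
  simp only [hessAt, chrAt_constMetric, ContinuousLinearMap.comp_zero, sub_zero]

/-- **Constant components are flat**: `R = 0`. [cite: ONeill1983, Ch. 3, Lemma 3.38] -/
theorem riemAt_constMetric (x X Y : E) : riemAt (fun _ : E ↦ Q₀) x X Y = 0 := by
  have h0 : chrAt (fun _ : E ↦ Q₀) = fun _ ↦ 0 := funext fun y ↦ chrAt_constMetric Q₀ y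
  simp only [riemAt, h0, fderiv_fun_const, Pi.zero_apply, _root_.zero_apply,
    ContinuousLinearMap.comp_zero, sub_self, add_zero]

/-- Constant components have vanishing Ricci form. [cite: ONeill1983, Ch. 3, Lemma 3.52] -/
theorem ricAt_constMetric [FiniteDimensional ℝ E] (x : E) : ricAt (fun _ : E ↦ Q₀) x = 0 := by
  ext Y Z
  simp only [ricAt_apply, _root_.zero_apply]
  have : ricciEndo (fun _ : E ↦ Q₀) x Y Z = 0 := by
    ext X
    simp only [ricciEndo_apply, riemAt_constMetric, _root_.zero_apply, LinearMap.zero_apply]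
  rw [this, map_zero]

/-- **Constant components have vanishing scalar curvature.** [cite: ONeill1983, Ch. 3, Def. 3.53] -/
theorem scalAt_constMetric [FiniteDimensional ℝ E] (x : E) : scalAt (fun _ : E ↦ Q₀) x = 0 := by
  simp only [scalAt, ricAt_constMetric, mtrAt, ContinuousLinearMap.comp_zero,
    ContinuousLinearMap.toLinearMap_zero, map_zero]

section Orthonormal

variable {ι : Type*} [Fintype ι] [DecidableEq ι] (b : Module.Basis ι ℝ E)
  (hb : ∀ i j, Q₀ (b i) (b j) = if i = j then 1 else 0) (hs : ∀ v w, Q₀ v w = Q₀ w v)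
include hb

/-- A form with an orthonormal basis is invertible. [folklore] -/
theorem isInvertible_of_orthonormal [FiniteDimensional ℝ E] : (Q₀ : E →L[ℝ] E →L[ℝ] ℝ).IsInvertible := by
  refine isInvertible_of_nondegenerate fun v hv ↦ ?_
  have h := sum_apply_smul_of_orthonormal (G := fun _ : E ↦ Q₀) (x := (0 : E)) b hb v
  rw [← h]
  simp [hv]

include hs in
/-- `♯α = Σᵢ α(bᵢ) bᵢ` for constant components with orthonormal basis `b`.
[cite: ONeill1983, Ch. 3, p. 60] -/
theorem sharpAt_constMetric [FiniteDimensional ℝ E] (x : E) (α : E →L[ℝ] ℝ) :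
    sharpAt (fun _ : E ↦ Q₀) x α = ∑ i, α (b i) • b i := by
  refine sharpAt_eq_of_forall (isInvertible_of_orthonormal Q₀ b hb) fun w ↦ ?_
  show Q₀ (∑ i, α (b i) • b i) w = α w
  rw [map_sum, _root_.sum_apply]
  conv_rhs => rw [← sum_apply_smul_of_orthonormal (G := fun _ : E ↦ Q₀) (x := x) b hb w, map_sum]
  refine Finset.sum_congr rfl fun i _ ↦ ?_
  rw [map_smul, _root_.smul_apply, smul_eq_mul, map_smul, smul_eq_mul, hs (b i) w, mul_comm]

include hs in
/-- **The pairing of covectors for constant components**: `α(♯β) = Σᵢ α(bᵢ) β(bᵢ)`.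
[cite: ONeill1983, Ch. 3, p. 60] -/
theorem apply_sharpAt_constMetric [FiniteDimensional ℝ E] (x : E) (α β : E →L[ℝ] ℝ) :
    α (sharpAt (fun _ : E ↦ Q₀) x β) = ∑ i, α (b i) * β (b i) := by
  rw [sharpAt_constMetric Q₀ b hb hs x β, map_sum]
  refine Finset.sum_congr rfl fun i _ ↦ ?_
  rw [map_smul, smul_eq_mul, mul_comm]

include hs in
/-- **The gradient square for constant components**: `|∇F|² = Σᵢ (∂_{bᵢ} F)²`.
[cite: ONeill1983, Ch. 3, p. 85] -/
theorem gradSqAt_constMetric [FiniteDimensional ℝ E] (F : E → ℝ) (x : E) :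
    gradSqAt (fun _ : E ↦ Q₀) F x = ∑ i, (fderiv ℝ F x (b i)) ^ 2 := by
  rw [gradSqAt_apply, apply_sharpAt_constMetric Q₀ b hb hs]
  exact Finset.sum_congr rfl fun i _ ↦ by ring

/-- **The Laplacian for constant components**: `ΔF = Σᵢ D²F(bᵢ, bᵢ)`.
[cite: ONeill1983, Ch. 3, Def. 3.50] -/
theorem lapAt_constMetric [FiniteDimensional ℝ E] (F : E → ℝ) (x : E) :
    lapAt (fun _ : E ↦ Q₀) F x = ∑ i, fderiv ℝ (fderiv ℝ F) x (b i) (b i) := by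
  classical
  rw [lapAt, hessAt_constMetric, mtrAt_eq_sum b]
  simp only [ginv_of_orthonormal (G := fun _ : E ↦ Q₀) b hb (isInvertible_of_orthonormal Q₀ b hb),
    ite_mul, one_mul, zero_mul, Finset.sum_ite_eq, Finset.mem_univ, if_true]

end Orthonormal

end MetricCoord

/-! ### Manifold level: a chart in which the metric is Euclidean on a ball -/

section FlatChart

open Literature.Geometry.Riemannian PseudoRiemannianMetric

variable {n : ℕ} {N : Type*} [TopologicalSpace N] [ChartedSpace (EuclideanSpace ℝ (Fin n)) N]
  [IsManifold 𝓘(ℝ, EuclideanSpace ℝ (Fin n)) ∞ N]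
  (g : PseudoRiemannianMetric 𝓘(ℝ, EuclideanSpace ℝ (Fin n)) ∞ (EuclideanSpace ℝ (Fin n))
    (TangentSpace 𝓘(ℝ, EuclideanSpace ℝ (Fin n)) : N → Type _))
  {e : OpenPartialHomeomorph N (EuclideanSpace ℝ (Fin n))}
  (he : e ∈ IsManifold.maximalAtlas 𝓘(ℝ, EuclideanSpace ℝ (Fin n)) ∞ N)
  {B : Set (EuclideanSpace ℝ (Fin n))} (hBo : IsOpen B) (hBe : B ⊆ e.target)
  (hflat : ∀ z ∈ B, ∀ v w,
    g.val (e.symm z) v w = (euclideanMetric (EuclideanSpace ℝ (Fin n))).val z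
      (mfderiv 𝓘(ℝ, EuclideanSpace ℝ (Fin n)) 𝓘(ℝ, EuclideanSpace ℝ (Fin n)) e (e.symm z) v)
      (mfderiv 𝓘(ℝ, EuclideanSpace ℝ (Fin n)) 𝓘(ℝ, EuclideanSpace ℝ (Fin n)) e (e.symm z) w))

include he

omit he in
/-- The standard basis of `ℝⁿ` is orthonormal for the Euclidean form. [folklore] -/
theorem innerSL_basisFun_orthonormal (i j : Fin n) :
    (innerSL ℝ : EuclideanSpace ℝ (Fin n) →L[ℝ] EuclideanSpace ℝ (Fin n) →L[ℝ] ℝ)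
      ((EuclideanSpace.basisFun (Fin n) ℝ).toBasis i) ((EuclideanSpace.basisFun (Fin n) ℝ).toBasis j) =
      if i = j then 1 else 0 := by
  rw [innerSL_apply_apply, OrthonormalBasis.coe_toBasis]
  exact orthonormal_iff_ite.mp (EuclideanSpace.basisFun (Fin n) ℝ).orthonormal i j

include hBo hBe hflat in
/-- **In the flat ball the representative of the transported metric is the Euclidean form.**
[cite: ONeill1983, Ch. 3, pp. 90–91] -/
theorem metricRepr_eventuallyEq_of_flatOn {z : EuclideanSpace ℝ (Fin n)} (hz : z ∈ B) :
    MaxAtlasChart.metricRepr g he =ᶠ[𝓝 z]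
      fun _ ↦ (innerSL ℝ : EuclideanSpace ℝ (Fin n) →L[ℝ] EuclideanSpace ℝ (Fin n) →L[ℝ] ℝ) := by
  filter_upwards [hBo.mem_nhds hz] with y hy
  have hy' : y ∈ e.target := hBe hy
  have hrep := MaxAtlasChart.metric_val_eq_repr g he ⟨y, hy'⟩
  rw [← hrep]
  have ha := MaxAtlasChart.mfderiv_chart_comp_inv_apply he ⟨y, hy'⟩
  simp only [MaxAtlasChart.inv_apply] at ha
  ext a b
  rw [MaxAtlasChart.metric_val, hflat y hy, euclideanMetric_apply]
  exact (congrArg₂ (fun u v : EuclideanSpace ℝ (Fin n) ↦ inner ℝ u v) (ha a) (ha b)).trans rfl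

include hBo hBe hflat in
/-- **`|∇F|²` in a flat chart**: `|∇F|²(e⁻¹ z) = Σᵢ (∂ᵢ F̂(z))²`, `F̂ = F ∘ e⁻¹`.
[cite: ONeill1983, Ch. 3, p. 85] -/
theorem gradSq_of_flatOn {z : EuclideanSpace ℝ (Fin n)} (hz : z ∈ B) {F : N → ℝ}
    (hF : MDifferentiableAt 𝓘(ℝ, EuclideanSpace ℝ (Fin n)) 𝓘(ℝ, ℝ) F (e.symm z)) :
    g.gradSq F (e.symm z) =
      ∑ i, (fderiv ℝ (F ∘ e.symm) z (EuclideanSpace.single i 1)) ^ 2 := by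
  have h1 := MaxAtlasChart.gradSq_inv_eq g he ⟨z, hBe hz⟩ hF
  rw [h1, MetricCoord.gradSqAt_congr_metric
      (G' := fun _ ↦ (innerSL ℝ : EuclideanSpace ℝ (Fin n) →L[ℝ] EuclideanSpace ℝ (Fin n) →L[ℝ] ℝ))
      (metricRepr_eventuallyEq_of_flatOn g he hBo hBe hflat hz).eq_of_nhds,
    MetricCoord.gradSqAt_constMetric _ (EuclideanSpace.basisFun (Fin n) ℝ).toBasis
      (innerSL_basisFun_orthonormal) (fun v w ↦ real_inner_comm w v)]
  simp only [OrthonormalBasis.coe_toBasis, EuclideanSpace.basisFun_apply]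

include hBo hBe hflat in
/-- **The pairing of differentials in a flat chart**: `g⁻¹(dF₁, dF₂)(e⁻¹ z) = Σᵢ ∂ᵢF̂₁ ∂ᵢF̂₂`.
[cite: ONeill1983, Ch. 3, p. 60] -/
theorem innerDual_of_flatOn {z : EuclideanSpace ℝ (Fin n)} (hz : z ∈ B) {F₁ F₂ : N → ℝ}
    (h₁ : MDifferentiableAt 𝓘(ℝ, EuclideanSpace ℝ (Fin n)) 𝓘(ℝ, ℝ) F₁ (e.symm z))
    (h₂ : MDifferentiableAt 𝓘(ℝ, EuclideanSpace ℝ (Fin n)) 𝓘(ℝ, ℝ) F₂ (e.symm z)) :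
    g.innerDual (e.symm z)
        (mvfderiv 𝓘(ℝ, EuclideanSpace ℝ (Fin n)) F₁ (e.symm z) :
          TangentSpace 𝓘(ℝ, EuclideanSpace ℝ (Fin n)) (e.symm z) →ₗ[ℝ] ℝ)
        (mvfderiv 𝓘(ℝ, EuclideanSpace ℝ (Fin n)) F₂ (e.symm z) :
          TangentSpace 𝓘(ℝ, EuclideanSpace ℝ (Fin n)) (e.symm z) →ₗ[ℝ] ℝ) =
      ∑ i, fderiv ℝ (F₁ ∘ e.symm) z (EuclideanSpace.single i 1) *
        fderiv ℝ (F₂ ∘ e.symm) z (EuclideanSpace.single i 1) := by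
  have h1 := MaxAtlasChart.innerDual_inv_eq g he ⟨z, hBe hz⟩ h₁ h₂
  rw [h1, MetricCoord.sharpAt_congr_metric
      (G' := fun _ ↦ (innerSL ℝ : EuclideanSpace ℝ (Fin n) →L[ℝ] EuclideanSpace ℝ (Fin n) →L[ℝ] ℝ))
      (metricRepr_eventuallyEq_of_flatOn g he hBo hBe hflat hz).eq_of_nhds,
    MetricCoord.apply_sharpAt_constMetric _ (EuclideanSpace.basisFun (Fin n) ℝ).toBasis
      (innerSL_basisFun_orthonormal) (fun v w ↦ real_inner_comm w v)]
  simp only [OrthonormalBasis.coe_toBasis, EuclideanSpace.basisFun_apply]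

variable [g.HasLeviCivita]

include hBo hBe hflat in
/-- **The Laplacian in a flat chart**: `Δ_g F (e⁻¹ z) = Σᵢ ∂ᵢ∂ᵢ F̂(z)`.
[cite: ONeill1983, Ch. 3, Prop. 3.13 and Def. 3.50] -/
theorem dalembertian_of_flatOn {z : EuclideanSpace ℝ (Fin n)} (hz : z ∈ B) {F : N → ℝ}
    (hF : ContMDiffAt 𝓘(ℝ, EuclideanSpace ℝ (Fin n)) 𝓘(ℝ, ℝ) 2 F (e.symm z)) :
    g.dalembertian F (e.symm z) =
      ∑ i, fderiv ℝ (fderiv ℝ (F ∘ e.symm)) z (EuclideanSpace.single i 1) (EuclideanSpace.single i 1) := by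
  have h1 := MaxAtlasChart.dalembertian_inv_eq g he ⟨z, hBe hz⟩ hF
  rw [h1, MetricCoord.lapAt_congr_metric_germ (metricRepr_eventuallyEq_of_flatOn g he hBo hBe hflat hz),
    MetricCoord.lapAt_constMetric _ (EuclideanSpace.basisFun (Fin n) ℝ).toBasis
      (innerSL_basisFun_orthonormal)]
  simp only [OrthonormalBasis.coe_toBasis, EuclideanSpace.basisFun_apply]

include hBo hBe hflat in
/-- **A flat chart has vanishing scalar curvature**: `S_g(e⁻¹ z) = 0` on the flat ball.
[cite: ONeill1983, Ch. 3, Lemma 3.38 and Def. 3.53] -/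
theorem scalarCurvature_of_flatOn {z : EuclideanSpace ℝ (Fin n)} (hz : z ∈ B) :
    g.scalarCurvature (e.symm z) = 0 := by
  rw [MaxAtlasChart.scalarCurvature_inv_eq g he ⟨z, hBe hz⟩,
    MetricCoord.scalAt_congr_metric (metricRepr_eventuallyEq_of_flatOn g he hBo hBe hflat hz),
    MetricCoord.scalAt_constMetric]

end FlatChart

end Literature.Geometry.Lorentzian

end
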